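import Summits.ValiantsHypothesis.ValiantsHypothesis.Theorems.GeneratorObstructionsPerGenDegreeSuperQPSandwich
import Literature.Computability.AlgebraicComplexity.IK2020OrbitClosureInvariantBound

/-!
# Route GeneratorObstructions — K1 `PerGenDegreeSuperQP` (stmt-ValiantsHypothesis-11654),
# line `per-side-atoms`: the TRIVIALLY ALLOWED weights of the permanent (ambient type ∧ orbit
# type), the sandwich instance they define, and the EXTENSION-THRESHOLD dichotomy

Companion of `…Sandwich` (the sandwich no-go format: `S(per_m) ⊆ ⟨G⟩`,
`⟨G⟩ ∩ {degree ≥ q} ⊆ S(per_m)`, `G` of degree `≤ q` ⇒ atoms of `S(per_m)` are early).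

An occurring weight `χ` of `ℂ[Δ_m[per_m]]` passes two classical tests, both PROVED in the tree and
packaged here in the vocabulary of the line:

* `per_ambientType_of_occurs` — `χ` is an AMBIENT TYPE: it occurs in `ℂ[Sym^m ℂ^{m²}]`
  (`HasHighestWeight (coordRep (MatIdx m) ℂ m) χ`; the lift of highest-weight vectors along
  `ℂ[Sym^m] ↠ ℂ[Δ_m[per_m]]`, tree `hasHighestWeight_coordRep_of_orbitCoordRep_holds`; BLMW 2011
  §4.4) — a plethysm condition;
* `per_orbitType_of_occurs` — `χ` is an ORBIT TYPE: `χ = λ^*` (transported to `MatIdx m`) for a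
  partition `λ ⊢ m·d` with at most `m²` parts whose Weyl module has a nonzero vector invariant
  under the stabiliser of `per_m` (`IK2020.weylInvariantDim ℂ (m·m) λ (stab per_m) ≠ 0`; tree
  `IK2020.orbitMultiplicity_toMatIdx_le_weylInvariantDim`, BLMW 2011 (5.5.3), Ikenmeyer–Kandasamy
  2020 §9) — a condition on `H_per = T^{2m-2}·((S_m × S_m) ⋊ 2)`-invariants.

Call `χ` TRIVIALLY ALLOWED when it passes both (`per_triviallyAllowed_of_occurs`:
`S(per_m) ⊆ Triv(per_m)`). Two observations organise the open content of `stub_atomLate`: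

1. `stub_atomLate_false_of_extensionThreshold` — **the concrete sandwich instance.** If for some
   `c` and all large `m` (T2) every trivially allowed weight is a sum of trivially allowed
   weights of degree `-|ψ| ≤ q(m) = m·2^((log₂ m + c)^c)`, and (T1) every element of degree
   `≥ q(m)` of the monoid they generate OCCURS in `ℂ[Δ_m[per_m]]` (a quasi-polynomial EXTENSION
   THRESHOLD: beyond degree `q(m)` the only obstructions to occurrence are the two trivial ones),
   then the registered `stub_atomLate` is false (`…Sandwich.stub_atomLate_false_of_eventualSandwich`
   with `G_m` = the trivially allowed weights of degree `≤ q(m)`).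
2. `stub_atomLate_of_extensionThreshold_of_lateTrivialAtoms` — **conversely, modulo (T1) the
   stub is combinatorial.** If for every `c, m₀` some `m ≥ max(m₀,1)` has a threshold `q` beyond
   which every trivially allowed weight occurs, together with a trivially allowed weight of degree
   `≥ q` and `> 2^((log₂ m + c)^c)` admitting no splitting into two nonzero trivially allowed
   weights, then `stub_atomLate` holds verbatim (`atom_of_atom_overSet`: beyond an agreement
   threshold, atoms of the over-set are occurring atoms). So GIVEN quasi-polynomial extension
   thresholds, `stub_atomLate` is EQUIVALENT to: the set of trivially allowed weights of `per_m`
   — plethysm support intersected with the `H_per`-invariant support, no orbit-CLOSURE geometry —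
   has super-quasi-polynomial atoms for infinitely many `m`.

Why the intersection and not the orbit types alone (informal; NOT used in the proofs). The
nonpositive lift of the orbit monoid `S° = {λ : V_λ^{H_per} ≠ 0}` is too large to sandwich
`S(per_m)`: for `m ≥ 3` and every `d ≥ 3` the hook `λ_d = (dm-1, 1)` is an orbit type (the
weight space of `V_{(n-1,1)} = ker(S^{n-1}W ⊗ W → S^n W)` at a "magic" exponent matrix `μ` with
line sums `d` is the space of zero-sum functions on `supp μ`, and a `μ` with two distinct
nonzero entries has a `Stab(μ)`-invariant such function), but `(dm-1,1)` NEVER occurs in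
`S^d(S^m W)` (`dim S^d(S^mW)[(dm-1,1)] = dim S^d(S^mW)[(dm)] = 1`), so `λ_d^*` is a hole of
`S(per_m)` inside the lifted orbit monoid at every degree `d ≥ 3`, and the extension threshold
(T1) stated for orbit types alone is false for trivial (plethysm) reasons. Intersecting with the
ambient support removes exactly these; whether `Triv(per_m)` is generated in quasi-polynomial
degree (T2) is itself open (an intersection of two early-generated monoids need not be early
generated), and is — given (T1) — the whole content of the stub by item 2.

Honest framing: packaging of two proved containments and two elementary implications; neither
(T1) nor (T2) nor their negations is proved here; `stub_atomLate` (for `c ≥ 2`), K1 and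
`GenFlipThesis` remain OPEN; nothing here bears on VP versus VNP.
References: [BurgisserEtAl2011] §4.4, §5.5 (5.5.3); [IkenmeyerKandasamy2019] §9 (9.3)–(9.4);
[BurgisserIkenmeyer2017] Prop. 3.9 (orbit versus closure) as background only. [folklore]
-/

set_option linter.dupNamespace false

namespace Summit.ValiantsHypothesis.ValiantsHypothesis.Theorems.GeneratorObstructions.PerGenDegreeSuperQP

open MvPolynomial
open Literature.NumberTheory.DiophantineGeometry Literature.Computability.AlgebraicComplexity
  Literature.Computability.Complexity

/-! ### 1. Beyond an agreement threshold, atoms of an over-set are occurring atoms -/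

section OverSet

variable {σ : Type*} [Fintype σ]

/-- **Atoms transfer down beyond the agreement threshold.** Let `Occ ⊆ T` be properties of
weights agreeing beyond degree `q` (`T χ ∧ -|χ| ≥ q ⇒ Occ χ`). Then every `χ` with `T χ`,
`-|χ| ≥ q` and no splitting into two nonzero `T`-weights satisfies `Occ` and has no splitting
into two nonzero `Occ`-weights. [folklore] -/
theorem atom_of_atom_overSet (Occ T : Weight σ → Prop) {q : ℤ}
    (hOT : ∀ χ : Weight σ, Occ χ → T χ) (hT : ∀ χ : Weight σ, T χ → q ≤ -(Weight.size χ) → Occ χ)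
    {χ : Weight σ} (hχT : T χ) (hq : q ≤ -(Weight.size χ))
    (hatomT : ∀ χ₁ χ₂ : Weight σ, χ₁ + χ₂ = χ → χ₁ ≠ 0 → χ₂ ≠ 0 → ¬ T χ₁ ∨ ¬ T χ₂) :
    Occ χ ∧ ∀ χ₁ χ₂ : Weight σ, χ₁ + χ₂ = χ → χ₁ ≠ 0 → χ₂ ≠ 0 → ¬ Occ χ₁ ∨ ¬ Occ χ₂ := by
  refine ⟨hT χ hχT hq, fun χ₁ χ₂ hsum h1 h2 => ?_⟩
  rcases hatomT χ₁ χ₂ hsum h1 h2 with h | h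
  · exact Or.inl fun ho => h (hOT χ₁ ho)
  · exact Or.inr fun ho => h (hOT χ₂ ho)

end OverSet

/-! ### 2. The permanent: occurring weights are ambient types and orbit types -/

section Permanent

variable {m : ℕ}

/-- **Occurring weights of `ℂ[Δ_m[per_m]]` are ambient types** (occur in `ℂ[Sym^m ℂ^{m²}]`): the
lift of highest-weight vectors along the `GL`-equivariant surjection `ℂ[Sym^m] ↠ ℂ[Δ_m[per_m]]`
(tree `hasHighestWeight_coordRep_of_orbitCoordRep_holds`), for `1 ≤ m`. BLMW 2011 §4.4.
[cite: BurgisserEtAl2011, §4.4] -/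
theorem per_ambientType_of_occurs (hm : 1 ≤ m) {χ : Weight (MatIdx m)}
    (hχ : highestWeightSpace (orbitCoordRep (MvPolynomial.rename toLex (perPoly (Fin m) ℂ)) m) χ ≠ ⊥) :
    HasHighestWeight (coordRep (MatIdx m) ℂ m) χ :=
  hasHighestWeight_coordRep_of_orbitCoordRep_holds _ (by omega) (perFormLex_isHomogeneous m)
    (show HasHighestWeight (orbitCoordRep (MvPolynomial.rename toLex (perPoly (Fin m) ℂ)) m) χ from hχ)

/-- **Occurring weights of `ℂ[Δ_m[per_m]]` are orbit types**: an occurring `χ` is the transported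
dual weight `λ^*` of a partition `λ ⊢ d·m` with at most `m²` parts (tree
`exists_eq_dualOfPartition_of_hasHighestWeight_orbitCoordRep`, BLMW (5.2.2)) whose Weyl module
`{λ}` of `GL_{m²}` has a NONZERO vector invariant under the stabiliser of `per_m` (pulled back to
`GL (Fin (m·m)) ℂ` along `matIdxEquiv m`): `0 < mult_χ ≤ dim {λ}^{stab per_m}` (tree
`IK2020.orbitMultiplicity_toMatIdx_le_weylInvariantDim`). BLMW 2011 (5.5.3); IK 2020 §9.
[cite: BurgisserEtAl2011, §5.5 (5.5.3)] -/
theorem per_orbitType_of_occurs (hm : 1 ≤ m) {χ : Weight (MatIdx m)}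
    (hχ : highestWeightSpace (orbitCoordRep (MvPolynomial.rename toLex (perPoly (Fin m) ℂ)) m) χ ≠ ⊥) :
    ∃ (d : ℕ) (lam : Nat.Partition (d * m)), lam.parts.card ≤ m * m ∧
      χ = (Weight.dualOfPartition (m * m) lam).toMatIdx ∧
      IK2020.weylInvariantDim ℂ (m * m) lam
        ((linStabilizer (MvPolynomial.rename toLex (perPoly (Fin m) ℂ))).comap
          (reindexGL (matIdxEquiv m))) ≠ 0 := by
  haveI : Infinite ℂ := CharZero.infinite ℂ
  have hχ' : HasHighestWeight (orbitCoordRep (MvPolynomial.rename toLex (perPoly (Fin m) ℂ)) m) χ := hχ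
  obtain ⟨d, lam, hlam, hχeq⟩ :=
    exists_eq_dualOfPartition_of_hasHighestWeight_orbitCoordRep (matIdxEquiv m) _ hχ'
  have hχeq' : χ = (Weight.dualOfPartition (m * m) lam).toMatIdx := by
    rw [hχeq]
    rfl
  refine ⟨d, lam, hlam, hχeq', ?_⟩
  have hpos : 0 < orbitMultiplicity ℂ (MvPolynomial.rename toLex (perPoly (Fin m) ℂ)) m χ :=
    (orbitMultiplicity_pos_iff_hasHighestWeight _ (by omega) χ).mpr hχ'
  have hle := IK2020.orbitMultiplicity_toMatIdx_le_weylInvariantDim ℂ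
    (MvPolynomial.rename toLex (perPoly (Fin m) ℂ)) m lam hlam
  rw [hχeq'] at hpos
  exact Nat.ne_of_gt (hpos.trans_le hle)

/-- **`S(per_m) ⊆ Triv(per_m)`**: an occurring weight of `ℂ[Δ_m[per_m]]` (`1 ≤ m`) is TRIVIALLY
ALLOWED — an ambient type and an orbit type (conjunction of `per_ambientType_of_occurs` and
`per_orbitType_of_occurs`, in the shape used below). [cite: BurgisserEtAl2011, §4.4, §5.5] -/
theorem per_triviallyAllowed_of_occurs (hm : 1 ≤ m) {χ : Weight (MatIdx m)}
    (hχ : highestWeightSpace (orbitCoordRep (MvPolynomial.rename toLex (perPoly (Fin m) ℂ)) m) χ ≠ ⊥) :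
    HasHighestWeight (coordRep (MatIdx m) ℂ m) χ ∧
      ∃ (d : ℕ) (lam : Nat.Partition (d * m)), lam.parts.card ≤ m * m ∧
        χ = (Weight.dualOfPartition (m * m) lam).toMatIdx ∧
        IK2020.weylInvariantDim ℂ (m * m) lam
          ((linStabilizer (MvPolynomial.rename toLex (perPoly (Fin m) ℂ))).comap
            (reindexGL (matIdxEquiv m))) ≠ 0 :=
  ⟨per_ambientType_of_occurs hm hχ, per_orbitType_of_occurs hm hχ⟩

/-! ### 3. The sandwich instance and the extension-threshold dichotomy -/

/-- **No-go for `stub_atomLate` from a quasi-polynomial extension threshold.** Write `Triv χ`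
for "`χ` is an ambient type and an orbit type of `per_m`" (`per_triviallyAllowed_of_occurs`) and
`q(m) = m · 2^((log₂ m + c)^c)`. Suppose that for some `c` and all `m ≥ max(m₀, 1)`:
(T2) every trivially allowed weight lies in the monoid generated by the trivially allowed weights
of degree `-|ψ| ≤ q(m)`; (T1) every element of that monoid of degree `-|χ| ≥ q(m)` OCCURS in
`ℂ[Δ_m[per_m]]`. Then the registered `stub_atomLate` is false
(`stub_atomLate_false_of_eventualSandwich` with `G_m = {ψ : Triv ψ ∧ -|ψ| ≤ q(m)}`, using
`S(per_m) ⊆ Triv`). [folklore] -/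
theorem stub_atomLate_false_of_extensionThreshold
    (H : ∃ c m₀ : ℕ, ∀ m : ℕ, m₀ ≤ m → 1 ≤ m →
      (∀ χ : Weight (MatIdx m),
        (HasHighestWeight (coordRep (MatIdx m) ℂ m) χ ∧
          ∃ (d : ℕ) (lam : Nat.Partition (d * m)), lam.parts.card ≤ m * m ∧
            χ = (Weight.dualOfPartition (m * m) lam).toMatIdx ∧
            IK2020.weylInvariantDim ℂ (m * m) lam
              ((linStabilizer (MvPolynomial.rename toLex (perPoly (Fin m) ℂ))).comap
                (reindexGL (matIdxEquiv m))) ≠ 0) →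
        χ ∈ AddSubmonoid.closure {ψ : Weight (MatIdx m) |
          (HasHighestWeight (coordRep (MatIdx m) ℂ m) ψ ∧
            ∃ (d : ℕ) (lam : Nat.Partition (d * m)), lam.parts.card ≤ m * m ∧
              ψ = (Weight.dualOfPartition (m * m) lam).toMatIdx ∧
              IK2020.weylInvariantDim ℂ (m * m) lam
                ((linStabilizer (MvPolynomial.rename toLex (perPoly (Fin m) ℂ))).comap
                  (reindexGL (matIdxEquiv m))) ≠ 0) ∧
          -(Weight.size ψ) ≤ (m : ℤ) * 2 ^ ((Nat.log 2 m + c) ^ c)}) ∧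
      (∀ χ ∈ AddSubmonoid.closure {ψ : Weight (MatIdx m) |
          (HasHighestWeight (coordRep (MatIdx m) ℂ m) ψ ∧
            ∃ (d : ℕ) (lam : Nat.Partition (d * m)), lam.parts.card ≤ m * m ∧
              ψ = (Weight.dualOfPartition (m * m) lam).toMatIdx ∧
              IK2020.weylInvariantDim ℂ (m * m) lam
                ((linStabilizer (MvPolynomial.rename toLex (perPoly (Fin m) ℂ))).comap
                  (reindexGL (matIdxEquiv m))) ≠ 0) ∧
          -(Weight.size ψ) ≤ (m : ℤ) * 2 ^ ((Nat.log 2 m + c) ^ c)},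
        (m : ℤ) * 2 ^ ((Nat.log 2 m + c) ^ c) ≤ -(Weight.size χ) →
          highestWeightSpace (orbitCoordRep (MvPolynomial.rename toLex (perPoly (Fin m) ℂ)) m) χ ≠ ⊥)) :
    ¬ (∀ c m₀ : ℕ, ∃ m : ℕ, m₀ ≤ m ∧ 1 ≤ m ∧ ∃ χ : Weight (MatIdx m),
      highestWeightSpace (orbitCoordRep (MvPolynomial.rename toLex (perPoly (Fin m) ℂ)) m) χ ≠ ⊥ ∧
      (∀ χ₁ χ₂ : Weight (MatIdx m), χ₁ + χ₂ = χ → χ₁ ≠ 0 → χ₂ ≠ 0 →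
          highestWeightSpace (orbitCoordRep (MvPolynomial.rename toLex (perPoly (Fin m) ℂ)) m) χ₁ = ⊥ ∨ highestWeightSpace (orbitCoordRep (MvPolynomial.rename toLex (perPoly (Fin m) ℂ)) m) χ₂ = ⊥) ∧
      (m : ℤ) * 2 ^ ((Nat.log 2 m + c) ^ c) < -(Weight.size χ)) := by
  obtain ⟨c, m₀, hH⟩ := H
  refine stub_atomLate_false_of_eventualSandwich ⟨c, m₀, fun m hm₀ hm1 => ?_⟩
  obtain ⟨hT2, hT1⟩ := hH m hm₀ hm1
  refine ⟨_, fun g hg => hg.2, fun χ hχ => hT2 χ (per_triviallyAllowed_of_occurs hm1 hχ), hT1⟩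

/-- **Modulo the extension threshold, late atoms of the trivially allowed set give the stub.**
Suppose that for every `c, m₀` there are `m ≥ max(m₀, 1)` and a threshold `q` such that (T1 at
`m`) every trivially allowed weight of `per_m` of degree `-|χ| ≥ q` OCCURS in `ℂ[Δ_m[per_m]]`,
and a trivially allowed weight `χ` with `-|χ| ≥ q`, `-|χ| > m · 2^((log₂ m + c)^c)` and no
splitting into two nonzero trivially allowed weights. Then the registered `stub_atomLate` holds
verbatim: `χ` occurs by (T1) and a splitting into occurring weights would be a splitting into
trivially allowed ones (`atom_of_atom_overSet` with `per_triviallyAllowed_of_occurs`). [folklore] -/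
theorem stub_atomLate_of_extensionThreshold_of_lateTrivialAtoms
    (H : ∀ c m₀ : ℕ, ∃ m : ℕ, m₀ ≤ m ∧ 1 ≤ m ∧ ∃ q : ℤ,
      (∀ χ : Weight (MatIdx m),
        (HasHighestWeight (coordRep (MatIdx m) ℂ m) χ ∧
          ∃ (d : ℕ) (lam : Nat.Partition (d * m)), lam.parts.card ≤ m * m ∧
            χ = (Weight.dualOfPartition (m * m) lam).toMatIdx ∧
            IK2020.weylInvariantDim ℂ (m * m) lam
              ((linStabilizer (MvPolynomial.rename toLex (perPoly (Fin m) ℂ))).comap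
                (reindexGL (matIdxEquiv m))) ≠ 0) →
        q ≤ -(Weight.size χ) →
          highestWeightSpace (orbitCoordRep (MvPolynomial.rename toLex (perPoly (Fin m) ℂ)) m) χ ≠ ⊥) ∧
      ∃ χ : Weight (MatIdx m),
        (HasHighestWeight (coordRep (MatIdx m) ℂ m) χ ∧
          ∃ (d : ℕ) (lam : Nat.Partition (d * m)), lam.parts.card ≤ m * m ∧
            χ = (Weight.dualOfPartition (m * m) lam).toMatIdx ∧
            IK2020.weylInvariantDim ℂ (m * m) lam
              ((linStabilizer (MvPolynomial.rename toLex (perPoly (Fin m) ℂ))).comap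
                (reindexGL (matIdxEquiv m))) ≠ 0) ∧
        q ≤ -(Weight.size χ) ∧
        (∀ χ₁ χ₂ : Weight (MatIdx m), χ₁ + χ₂ = χ → χ₁ ≠ 0 → χ₂ ≠ 0 →
          ¬ (HasHighestWeight (coordRep (MatIdx m) ℂ m) χ₁ ∧
              ∃ (d : ℕ) (lam : Nat.Partition (d * m)), lam.parts.card ≤ m * m ∧
                χ₁ = (Weight.dualOfPartition (m * m) lam).toMatIdx ∧
                IK2020.weylInvariantDim ℂ (m * m) lam
                  ((linStabilizer (MvPolynomial.rename toLex (perPoly (Fin m) ℂ))).comap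
                    (reindexGL (matIdxEquiv m))) ≠ 0) ∨
          ¬ (HasHighestWeight (coordRep (MatIdx m) ℂ m) χ₂ ∧
              ∃ (d : ℕ) (lam : Nat.Partition (d * m)), lam.parts.card ≤ m * m ∧
                χ₂ = (Weight.dualOfPartition (m * m) lam).toMatIdx ∧
                IK2020.weylInvariantDim ℂ (m * m) lam
                  ((linStabilizer (MvPolynomial.rename toLex (perPoly (Fin m) ℂ))).comap
                    (reindexGL (matIdxEquiv m))) ≠ 0)) ∧
        (m : ℤ) * 2 ^ ((Nat.log 2 m + c) ^ c) < -(Weight.size χ)) :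
    ∀ c m₀ : ℕ, ∃ m : ℕ, m₀ ≤ m ∧ 1 ≤ m ∧ ∃ χ : Weight (MatIdx m),
      highestWeightSpace (orbitCoordRep (MvPolynomial.rename toLex (perPoly (Fin m) ℂ)) m) χ ≠ ⊥ ∧
      (∀ χ₁ χ₂ : Weight (MatIdx m), χ₁ + χ₂ = χ → χ₁ ≠ 0 → χ₂ ≠ 0 →
          highestWeightSpace (orbitCoordRep (MvPolynomial.rename toLex (perPoly (Fin m) ℂ)) m) χ₁ = ⊥ ∨ highestWeightSpace (orbitCoordRep (MvPolynomial.rename toLex (perPoly (Fin m) ℂ)) m) χ₂ = ⊥) ∧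
      (m : ℤ) * 2 ^ ((Nat.log 2 m + c) ^ c) < -(Weight.size χ) := by
  intro c m₀
  obtain ⟨m, hm₀, hm1, q, hT1, χ, hχT, hq, hatomT, hdeg⟩ := H c m₀
  have key := atom_of_atom_overSet
    (fun ψ => highestWeightSpace (orbitCoordRep (MvPolynomial.rename toLex (perPoly (Fin m) ℂ)) m) ψ ≠ ⊥)
    (fun ψ => HasHighestWeight (coordRep (MatIdx m) ℂ m) ψ ∧
      ∃ (d : ℕ) (lam : Nat.Partition (d * m)), lam.parts.card ≤ m * m ∧
        ψ = (Weight.dualOfPartition (m * m) lam).toMatIdx ∧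
        IK2020.weylInvariantDim ℂ (m * m) lam
          ((linStabilizer (MvPolynomial.rename toLex (perPoly (Fin m) ℂ))).comap
            (reindexGL (matIdxEquiv m))) ≠ 0)
    (fun ψ hψ => per_triviallyAllowed_of_occurs hm1 hψ) hT1 hχT hq hatomT
  refine ⟨m, hm₀, hm1, χ, key.1, fun χ₁ χ₂ hsum h1 h2 => ?_, hdeg⟩
  rcases key.2 χ₁ χ₂ hsum h1 h2 with h | h
  · left
    by_contra h'
    exact h h'
  · right
    by_contra h'
    exact h h'

end Permanent

end Summit.ValiantsHypothesis.ValiantsHypothesis.Theorems.GeneratorObstructions.PerGenDegreeSuperQP
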